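import Summits.BirchSwinnertonDyer.Rank1Residual.Additive.X3BranchMainConjectureGordOfFacts
import HarnessLib

/-!
# X3 on the semistable-twist locus: the per-pair CERTIFICATE ROAD at `W`-level — Wuthrich's half ∧
# [`λ_alg(W/ℚ_∞) = n`] ∧ [ONE unit coefficient of `ϖ·B_m` at index `n`] ⟹ Delbourgo's branch main
# conjecture of the additive curve, BOTH reduction types of the twist (good ordinary / multiplicative),
# BOTH parities — with NO analytic congruence (`hGV` / `hGVM` absent); rank-`0` end states in the sequels
# (cell `bsd-eis`, seat `bsd-eis-x3` gen 2; FULL-BSD rank-≤1 programme D-0033 tranche 1a, rows B2 X3-shares;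
# route K1 `AdditiveBranchIMC` cruxes `MultLower` / `GordTwoRankZeroOffCaseOne`, supports only)

HONEST FRAMING (cell `bsd-eis`, `run/shared/lean/pub/bsd-eis/README.md` §4): the programme's target of
record is the full Birch–Swinnerton-Dyer formula for every `E/ℚ` of analytic rank `≤ 1`; this file
concerns the X3 rows (`E` additive at an odd `p`, `E[p]` REDUCIBLE) of the semistable-twist locus
(`E = W = C • V^{(p*)}`, `V` good ordinary or multiplicative at `p`). THEOREMS ONLY (no `def`, no named
fact, no `sorry`); nothing is booked; no label, tier or count of record moves. X3 stays
CONSTRUCTION-SHAPED as a class: the two displayed per-pair inputs below are NOT in print and NOT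
asserted.

## What and why

Cell `bsd-addord` (seat `bsd-addord-twist`) landed the `W`-level branch main conjecture of the additive
curve from PUBLISHED facts on the (G-ord, `e = 2`) rows (`X3Branch.charIdeal_eq_span_of_facts`: the
analytic input is GV 2000 Thm. (3.12) read on the branch, `hGV`, PRINTED for `V` good ordinary) and on
the (M) rows MODULO the displayed analytic congruence `hGVM`
(`X3Branch.charIdeal_eq_span_of_multBranchCongruence_of_facts_of_lifting`), which is NOT in print
(GV's standing hypothesis excludes a character ramified at a prime dividing the level; cell `bsd-eis`
x3-MEMO-1 R2). This seat's p401455 (`X3BranchIsogenyCharacters.lean` §4) typed the per-pair BYPASS of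
the analytic half at the EIGEN level: `X3BranchUnitCoeffCertAt V p n` (ONE coefficient of `ϖ·B_m` of
`p`-adic norm `1` at the index `n` predicted by the algebraic half) + the algebraic half
`X3BranchAlgebraicLambdaAt V p n` + Wuthrich ⟹ `X3BranchMainConjectureAt V p`. The planner's routing
call (TARGET §1.4 ROUTING v1.8.9 (R1′)/(R2′), `plan-g11/X3-SUCCESSOR-BRIEF.md` §2) asks for the same
bypass AT `W`-LEVEL, where bsd-addord's algebraic counts live (the tree's eigen-descent
`SelmerDualData.exists_chiEigenInCyclotomic` goes `W → eigen` only). THIS FILE does exactly that, with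
the algebraic input abstracted to its USED content "`λ(g) = n` for every generator `g` of
`char_Λ X(W/ℚ_∞)` with `μ(g) = 0`" (`hLamW`), so that ONE composition serves every sub-row: the
non-degenerate rows through bsd-addord's counts (§3: count + the displayed evaluation
`p^{n + Σδ} = #H¹(ℚ_Σ/ℚ_∞, Φ₀)·#U` ⟹ `hLamW`), and the DEGENERATE `p = 3` rows (x3's own territory,
x3-MEMO-3 (ALG-deg′)) through their own count when it lands.

* §1 `X3Branch.charIdeal_eq_span_of_unitCoeffCert_of_lamEq` — POINTWISE at a half-eigen datum, ANY
  member of the reduction telescope (good ordinary / split / non-split multiplicative): Wuthrich gives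
  `g' = g·h ∈ char X_m = (g)` with `ι g' = C(uϖ)B`; the certificate gives `μ(g') = 0` and `λ(g') ≤ n`;
  hence `μ(g) = 0`, so `λ(g) = n` (`hlam`), `λ(gh) ≤ λ(g)`, `h ∈ Λˣ`, `char X_m = (g')`.
* §2 `X3Branch.charIdeal_eq_span_of_unitCoeffCert_of_lamEqW` — `W`-LEVEL by eigen-descent: for
  `C • V^{(p*)} = W`, `V[p]` reducible, EVERY `Λ`-dual datum `D` of `Sel_{p^∞}(W/ℚ_∞)`:
  `X(W/ℚ_∞)` torsion and `char_Λ X(W/ℚ_∞) = (g')`, `ι g' = u·ϖ·B` — from `hW16`, the certificate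
  and `hLamW`. No `Φ₀`, no `Σ₀`, no reduction hypothesis beyond the telescope.
* §3 `X3Branch.lamEqW_of_count_of_eval` — `hLamW` from a residual COUNT of bsd-addord's shape
  (`p^{λ(g)+Σδ} = #H¹(ℚ_Σ/ℚ_∞, Φ₀)·#U`) + the displayed EVALUATION `hn` (the count read as a number:
  GV Props. (2.6)/(2.8), Cor. (2.3) with Iwasawa / Ferrero–Washington / Mazur–Wiles — per pair an
  instrument datum once the character-`L`-function `λ`'s are certified; displayed, NOT asserted).
* SEQUELS (same seat): `X3BranchCertificateRoadMult.lean` — the `T = 0` LOWER inputs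
  `ChiBranchLowerLeadingTerm[Odd]At W p`, `Typed.MissingLowerBoundAt W p` (the currency of route K1's
  crux `MultLower`) and Miller's `BSDp W p` on X3♯(M) ∧ `r_an = 0` from PUBLISHED records + `hcert`
  + `hLamW` (the `hGVM`-FREE twins of bsd-addord's (M) end states), and `hLamW` on (M) from the
  count `X3Branch.algebraicCountWMult_of_facts_of_lifting` + `hn`; `X3BranchCertificateRoadGord.lean`
  — the same on X3♯(G-ord, `e = 2`) ∧ `r_an = 0` with the intrinsic Delbourgo factor (anomalous
  twists included, no CM hypothesis), which is also the typed home of the DEGENERATE `p = 3` rows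
  (no Case-1 member; crux `GordTwoRankZeroOffCaseOne`) once their `hLamW` (x3-MEMO-3 (ALG-deg′),
  `n = Σ s_ℓ t_ℓ(E) − 2`) lands.

## What this is NOT

Not a class theorem and not a booking. The certificate `X3BranchUnitCoeffCertAt V p n` is a per-pair
INSTRUMENT datum (exact modular symbols; x3 STEP-0 engine `HOME/x3/branchgv.gp`, 77/77 + 140/140 rows
of record are EVIDENCE for `λ_an`, not certificates of a unit coefficient); `hLamW` is the algebraic
`λ` — a THEOREM modulo print on the non-degenerate rows only through §3's displayed evaluation `hn`,
OPEN on the degenerate `p = 3` rows until (ALG-deg′) lands. Not rank `1` (row B6: the branch `p`-adic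
Gross–Zagier formula and Schneider's height are other seats' objects). Not `e ∈ {3,4,6}`, not `p = 2`,
not the parity-BAD rows (`μ > 0` side).

References: [GreenbergVatsal2000] p. 4, §2 (11), (16), pp. 26–30, Props. (2.6), (2.8), Cor. (2.3);
[Wuthrich2014] Thm. 16; [MazurTateTeitelbaum1986Invent] §I.13–I.14; [Delbourgo1998] Thm. 3, Prop. 4,
Main Conjecture p. 151; [Delbourgo2002] Thm. (A)/(B); [Pal2012] Thm. 3.2; [GreenbergLNM1716] Props.
2.2, 2.4, 4.14, §5 p. 143; [SilvermanATAEC1994] V.5.3/5.4; [Miller2011LMS] Def. 1.1; [Washington1997]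
§7.1; cell files `run/shared/lean/pub/bsd-eis/x3-MEMO-{1,2,3}.md`, `plan-g11/X3-SUCCESSOR-BRIEF.md`.
-/

set_option autoImplicit false

noncomputable section

open scoped Classical MatrixGroups ModularForm

namespace Summit.BirchSwinnertonDyer.Rank1Residual.Additive

open CongruenceSubgroup WeierstrassCurve NumberField IsDedekindDomain Field
  Literature.NumberTheory.EllipticCurves
  Literature.NumberTheory.EllipticCurves.ModularForms
  Literature.NumberTheory.EllipticCurves.GreenbergVatsal2000
  Literature.NumberTheory.EllipticCurves.Rank1Residual
  Literature.NumberTheory.EllipticCurves.Rank1Residual.Typed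
  Literature.NumberTheory.GaloisRepresentations
  Summit.BirchSwinnertonDyer.Rank1Residual.X1.MuLambda
  Summit.BirchSwinnertonDyer.Rank1Residual.AdditivePotMult
  Summit.BirchSwinnertonDyer.Rank1Residual.Additive.X3Branch

/-! ### §1 POINTWISE at a half-eigen datum: Wuthrich ∧ certificate ∧ `λ(g) = n` -/

section Pointwise

variable {V : WeierstrassCurve ℚ} [V.IsElliptic] [V.IsGloballyMinimal] {p : ℕ} [hp : Fact p.Prime]

/-- **CERTIFICATE ROAD, POINTWISE in the half-eigen datum, every member of the reduction telescope.**
`V` globally minimal, `V[p]` reducible, `(K, F, κ, γ, f, B, ϖ)` ONE instance of the telescope of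
`Wuthrich2014.thm16_halfEigenCharIdeal_dvd_cyclotomicPrime` (good ordinary / split / non-split
multiplicative `B`), `D` ONE half-eigen `Λ`-dual datum. IF the unit-coefficient certificate
`X3BranchUnitCoeffCertAt V p n` holds and every generator `g` of `char_Λ D.X` with `μ(g) = 0` has
`λ(g) = n` (`hlam`), THEN `D.X` is `Λ`-torsion and `char_Λ D.X = (g')` with `ι g' = u·ϖ·B`. Proof:
Wuthrich gives `g' = g·h ∈ (g) = char D.X`, `ι g' = C(uϖ)B`; the certificate read on `Λ`
(`hasUnitContent_and_lam_le_of_iota_eq_of_norm_coeff_eq_one`) gives `μ(g') = 0`, `λ(g') ≤ n`; so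
`μ(g) = 0` (`hasUnitContent_left_of_mul`), `λ(g) = n ≥ λ(gh)`, and the generator criterion
`span_mul_eq_span_of_hasUnitContent_of_lam_le` gives `(gh) = (g)`. Pure `Λ`-algebra over two typed
inputs; NOT a class theorem. [cite: Wuthrich2014, Thm. 16 (p. 397)]
[cite: GreenbergVatsal2000, p. 4 (after Thm. (1.2))] [cite: Washington1997, §7.1] -/
theorem X3Branch.charIdeal_eq_span_of_unitCoeffCert_of_lamEq
    (hW16 : Wuthrich2014.thm16_halfEigenCharIdeal_dvd_cyclotomicPrime) {n : ℕ}
    (hcert : X3BranchUnitCoeffCertAt V p n)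
    (K : Type) [Field K] [NumberField K] [(galRange (K := ℚ) K).Normal]
    (F : Type) [Field F] [NumberField F] [IsCyclotomicExtension {p} ℚ F]
    [(galRange (K := ℚ) F).Normal]
    {κ : ZpExtension ℚ p} {γ : Field.absoluteGaloisGroup ℚ} {N : ℕ} [NeZero N]
    {f : CuspForm (Gamma0 N) 2} {B : PowerSeries ℚ_[p]}
    (hp2 : p ≠ 2) (h2 : Module.finrank ℚ K = 2)
    (hθ : ∃ θ : K, θ ^ 2 = algebraMap ℚ K ((-1) ^ (p / 2) * p))
    (hred : (IsOrdinaryAt V p ∧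
        B = if Even (p / 2) then padicLFunctionBranch f ((unitRoot V p : ℤ_[p]) : ℚ_[p]) (p / 2)
          else padicLFunctionMinusBranch f ((unitRoot V p : ℤ_[p]) : ℚ_[p]) (p / 2)) ∨
      (V.HasSplitMultiplicativeReductionAtPrime p ∧
        B = if Even (p / 2) then padicLFunctionPlusBranchMult f (1 : ℚ_[p]) (p / 2)
          else padicLFunctionMinusBranchMult f (1 : ℚ_[p]) (p / 2)) ∨
      (V.HasMultiplicativeReductionAtPrime p ∧ ¬ V.HasSplitMultiplicativeReductionAtPrime p ∧
        B = if Even (p / 2) then padicLFunctionPlusBranchMult f (-1 : ℚ_[p]) (p / 2)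
          else padicLFunctionMinusBranchMult f (-1 : ℚ_[p]) (p / 2)))
    (hirr : ¬ V.HasIrreducibleModPGaloisRep p)
    (hκ : κ.IsCyclotomic) (hγ : κ.IsTopGenerator γ) (hcyc : IsCyclotomicVariable p γ)
    (hγK : γ ∈ galRange (K := ℚ) K) (hγF : γ ∈ galRange (K := ℚ) F) (hf : IsNewformOf V f)
    (D : V.EigenSelmerDualData p
        (κ.kerSubgroup ⊓ galRange (K := ℚ) K ⊓ galRange (K := ℚ) F) κ.kerSubgroup
        (fun g ↦ if g ∈ galRange (K := ℚ) K then 1 else -1) γ)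
    (ϖ : ℚ) (hϖ : if Even (p / 2) then (ϖ : ℝ) * V.realPeriodRat = plusPeriod f
        else (ϖ : ℝ) * V.imaginaryPeriodRat = minusPeriod f)
    (hlam : ∀ g : IwasawaAlgebra p, D.charIdeal = Ideal.span {g} → HasUnitContent g → lam g = n) :
    Module.IsTorsion (IwasawaAlgebra p) D.X ∧
      ∃ g' : IwasawaAlgebra p, D.charIdeal = Ideal.span {g'} ∧ ∃ u : ℤ_[p]ˣ,
        iwasawaToPowerSeries p g' = PowerSeries.C (((u : ℤ_[p]) : ℚ_[p]) * (ϖ : ℚ_[p])) * B := by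
  obtain ⟨htors, g', hg'mem, u, hι⟩ :=
    hW16 p V K F B hp2 h2 hθ hred hirr hκ hγ hcyc hγK hγF hf D ϖ hϖ
  refine ⟨htors, ?_⟩
  -- `char D.X = (g)` is principal; `g' = g·h`
  obtain ⟨g, hg⟩ := (charIdeal_isPrincipal_holds p D.X).principal
  have hchar : D.charIdeal = Ideal.span {g} := hg
  obtain ⟨h, hfac⟩ : g ∣ g' := by
    rw [hchar] at hg'mem
    exact Ideal.mem_span_singleton.mp hg'mem
  subst hfac
  -- the certificate read on `Λ`: `μ(g·h) = 0`, `λ(g·h) ≤ n`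
  obtain ⟨hμ', hlam'⟩ :=
    hasUnitContent_and_lam_le_of_iota_eq_of_norm_coeff_eq_one hι (hcert f B ϖ hred hf hϖ)
  have hμg : HasUnitContent g := X11a.hasUnitContent_left_of_mul hμ'
  -- the algebraic `λ` at `g`
  have hlamg : lam g = n := hlam g hchar hμg
  refine ⟨g * h, hchar.trans ?_, u, hι⟩
  exact (span_mul_eq_span_of_hasUnitContent_of_lam_le (X11a.ne_zero_of_hasUnitContent hμg) hμ'
    (hlamg ▸ hlam')).symm

end Pointwise

/-! ### §2 `W`-LEVEL by eigen-descent: the branch main conjecture of the additive curve -/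

section WLevel

variable {V : WeierstrassCurve ℚ} [V.IsElliptic] [V.IsGloballyMinimal]
  {W : WeierstrassCurve ℚ} {p : ℕ} [hp : Fact p.Prime]

/-- **CERTIFICATE ROAD AT `W`-LEVEL — Delbourgo's branch main conjecture of the ADDITIVE curve in
Greenberg form, (G) and (M), both parities, with NO analytic congruence.** `V` globally minimal with
`V[p]` reducible at the odd `p`, `C • V^{(p*)} = W` (`W = E` additive), `κ` cyclotomic with a
topological generator `γ` matching the cyclotomic variable, `f` the newform of `V`, `B` a branch
series of the reduction telescope (good ordinary: `L_p(f, α_V, ω^m, T)`; split / non-split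
multiplicative: `L_p^{±}(f, ±1, ω^m, T)`), `ϖ` the period ratio of the parity of `m = (p−1)/2`,
`D` ANY `Λ`-dual datum of `Sel_{p^∞}(W/ℚ_∞)`. DISPLAYED per-pair inputs: the unit-coefficient
certificate `hcert : X3BranchUnitCoeffCertAt V p n` and `hLamW` := "for every cyclotomic `κ'`,
generator `γ'`, TORSION dual datum `D'` of `Sel_{p^∞}(W/ℚ_∞)` and generator `g` of `char D'.X` with
`μ(g) = 0`: `λ(g) = n`" (the algebraic `λ` of `X(E/ℚ_∞)`; on the non-degenerate branch-parity rows
= bsd-addord's count + §3's evaluation; on the degenerate `p = 3` rows = x3's (ALG-deg′), not yet in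
the kernel). THEN `X(W/ℚ_∞)` is `Λ`-torsion and `char_Λ X(W/ℚ_∞) = (g')` with `ι g' = u·ϖ·B`,
`u ∈ ℤ_pˣ` — granted ONLY Wuthrich's PUBLISHED Thm. 16 (`hW16`). Proof: descend `D` to the
`χ_K`-eigen datum `D'` over `ℚ(μ_{p^∞})` with the same characteristic ideal and torsion-ness
(`SelmerDualData.exists_chiEigenInCyclotomic`, `K = ℚ(√p*) ⊂ ℚ(ζ_p)`, `γ' = γ·g₀`, `g₀ ∈ ker κ`);
Wuthrich at `D'.toEigen` gives torsion (fed to `hLamW`); §1 at `D'.toEigen`.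
[cite: GreenbergLNM1716, §5 (PDF p. 143)] [cite: Wuthrich2014, Thm. 16 (p. 397)]
[cite: Delbourgo1998, Main Conjecture (p. 151)] [cite: GreenbergVatsal2000, p. 4 (after Thm. (1.2))] -/
theorem X3Branch.charIdeal_eq_span_of_unitCoeffCert_of_lamEqW
    (hW16 : Wuthrich2014.thm16_halfEigenCharIdeal_dvd_cyclotomicPrime)
    (hp2 : p ≠ 2) (hirr : ¬ V.HasIrreducibleModPGaloisRep p) {C : VariableChange ℚ}
    (hC : C • V.quadraticTwist ((-1) ^ (p / 2) * p : ℚ) = W) {n : ℕ}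
    (hcert : X3BranchUnitCoeffCertAt V p n)
    (hLamW : ∀ {κ : ZpExtension ℚ p} {γ : Field.absoluteGaloisGroup ℚ} (D : W.SelmerDualData κ γ)
      (g : IwasawaAlgebra p), κ.IsCyclotomic → κ.IsTopGenerator γ → D.IsTorsion →
      D.charIdeal = Ideal.span {g} → HasUnitContent g → lam g = n)
    {κ : ZpExtension ℚ p} {γ : Field.absoluteGaloisGroup ℚ} {N : ℕ} [NeZero N]
    {f : CuspForm (Gamma0 N) 2} {B : PowerSeries ℚ_[p]}
    (hκ : κ.IsCyclotomic) (hγ : κ.IsTopGenerator γ) (hcv : IsCyclotomicVariable p γ)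
    (hf : IsNewformOf V f)
    (hred : (IsOrdinaryAt V p ∧
        B = if Even (p / 2) then padicLFunctionBranch f ((unitRoot V p : ℤ_[p]) : ℚ_[p]) (p / 2)
          else padicLFunctionMinusBranch f ((unitRoot V p : ℤ_[p]) : ℚ_[p]) (p / 2)) ∨
      (V.HasSplitMultiplicativeReductionAtPrime p ∧
        B = if Even (p / 2) then padicLFunctionPlusBranchMult f (1 : ℚ_[p]) (p / 2)
          else padicLFunctionMinusBranchMult f (1 : ℚ_[p]) (p / 2)) ∨
      (V.HasMultiplicativeReductionAtPrime p ∧ ¬ V.HasSplitMultiplicativeReductionAtPrime p ∧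
        B = if Even (p / 2) then padicLFunctionPlusBranchMult f (-1 : ℚ_[p]) (p / 2)
          else padicLFunctionMinusBranchMult f (-1 : ℚ_[p]) (p / 2)))
    (D : W.SelmerDualData κ γ) (ϖ : ℚ)
    (hϖ : if Even (p / 2) then (ϖ : ℝ) * V.realPeriodRat = plusPeriod f
        else (ϖ : ℝ) * V.imaginaryPeriodRat = minusPeriod f) :
    D.IsTorsion ∧ ∃ g' : IwasawaAlgebra p, D.charIdeal = Ideal.span {g'} ∧ ∃ u : ℤ_[p]ˣ,
      iwasawaToPowerSeries p g' = PowerSeries.C (((u : ℤ_[p]) : ℚ_[p]) * (ϖ : ℚ_[p])) * B := by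
  have hpS : ((-1 : ℚ) ^ (p / 2) * p) ≠ 0 := pStar_ne_zero p
  -- descend `D` to the `χ_K`-eigen datum over `ℚ(μ_{p^∞})`
  haveI hcycL : IsCyclotomicExtension {p} ℚ (CyclotomicField p ℚ) := by
    have h : (CyclotomicField.algebra p ℚ : Algebra ℚ (CyclotomicField p ℚ)) =
        DivisionRing.toRatAlgebra := Subsingleton.elim _ _
    exact h ▸ CyclotomicField.isCyclotomicExtension p ℚ
  obtain ⟨K, θ, hK2, hθ, hθ2⟩ := exists_intermediateField_sq_eq_pStar p (CyclotomicField p ℚ) hp2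
  haveI : NumberField K := NumberField.of_module_finite ℚ K
  haveI : IsGalois ℚ K := isGalois_of_finrank_eq_two K hK2
  haveI := normal_galRange K hK2 (sigmaQ_ne_one K hK2 hθ hθ2)
  haveI := normal_galRange_cyclotomic p (CyclotomicField p ℚ)
  haveI : (V.quadraticTwist ((-1 : ℚ) ^ (p / 2) * p)).IsElliptic := V.isElliptic_quadraticTwist hpS
  obtain ⟨γ', hγ'KF, hκγ', ⟨g₀, hg₀, hγ'eq⟩, D', hchar, htor⟩ :=
    SelmerDualData.exists_chiEigenInCyclotomic p (CyclotomicField p ℚ) V K hK2 hθ hθ2 κ hC hp2 D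
  have hγ' : κ.IsTopGenerator γ' := isTopGenerator_of_kappa_eq κ hκγ' hγ
  have hcv' : IsCyclotomicVariable p γ' := isCyclotomicVariable_of_eq_mul p κ hκ hg₀ hγ'eq hcv
  -- Wuthrich's Thm. 16 at the eigen datum: the module `D'.X = D.X` is `Λ`-torsion
  obtain ⟨htorsE, -⟩ := hW16 p V K (CyclotomicField p ℚ) _ hp2 hK2 ⟨θ, hθ2⟩ hred
    hirr hκ hγ' hcv' (Subgroup.mem_inf.mp hγ'KF).1 (Subgroup.mem_inf.mp hγ'KF).2 hf
    (ChiEigenSelmerInDualData.toEigen V K κ (galRange (K := ℚ) (CyclotomicField p ℚ)) γ' D') ϖ hϖ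
  have htorsD : D.IsTorsion := htor.mp htorsE
  -- §1 at the Literature eigen datum with the SAME characteristic ideal
  have key := X3Branch.charIdeal_eq_span_of_unitCoeffCert_of_lamEq (V := V) hW16 hcert K
    (CyclotomicField p ℚ) (κ := κ) (γ := γ') (f := f) (B := B) hp2 hK2 ⟨θ, hθ2⟩ hred hirr hκ hγ'
    hcv' (Subgroup.mem_inf.mp hγ'KF).1 (Subgroup.mem_inf.mp hγ'KF).2 hf
    (ChiEigenSelmerInDualData.toEigen V K κ (galRange (K := ℚ) (CyclotomicField p ℚ)) γ' D') ϖ hϖ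
    (fun g hg hμ ↦ hLamW D g hκ hγ htorsD (hchar ▸ hg) hμ)
  obtain ⟨-, g', hchar', u, hι⟩ := key
  exact ⟨htorsD, g', hchar ▸ hchar', u, hι⟩

end WLevel

/-! ### §3 `hLamW` from a residual COUNT + the displayed EVALUATION of the count -/

section Evaluation

variable {W : WeierstrassCurve ℚ} [W.IsElliptic] [W.IsGloballyMinimal] {p : ℕ} [hp : Fact p.Prime]

omit [W.IsElliptic] [W.IsGloballyMinimal] in
/-- **Count + evaluation ⟹ `λ(g) = n`.** If every generator `g` (of unit content) of `char_Λ D.X` of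
every torsion dual datum `D` of `Sel_{p^∞}(W/ℚ_∞)` satisfies GV's residual count
`p^{λ(g) + Σ_{ℓ∈Σ₀} δ_ℓ(W)} = #H¹(ℚ_Σ/ℚ_∞, Φ₀)·#U(W[p]/Φ₀)` (`hcount`: bsd-addord's
`X3Branch.algebraicCountW[Mult]_of_facts[_of_lifting]`), and the count is EVALUATED as
`p^{n + Σδ} = #H¹·#U` for every cyclotomic `κ` (`hn` — GV Props. (2.6)/(2.8), Cor. (2.3) with
Iwasawa / Ferrero–Washington / Mazur–Wiles give `#H¹ = p^{λ_{χφ,Σ₀}}`, `#U = p^{λ_{χψ,Σ₀}}`; per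
pair an instrument datum; displayed, NOT asserted), then `λ(g) = n`. Injectivity of `p^·`.
[cite: GreenbergVatsal2000, §2 Props. (2.6), (2.8), Cor. (2.3), pp. 28–30] -/
theorem X3Branch.lamEqW_of_count_of_eval (S₀ : Finset (HeightOneSpectrum (𝓞 ℚ)))
    {Φ₀ : AddSubgroup (W.geomTorsion (p : ℤ))} (hΦ : IsRationalLine W p Φ₀) {n : ℕ}
    (hcount : ∀ {κ : ZpExtension ℚ p} {γ : Field.absoluteGaloisGroup ℚ} (D : W.SelmerDualData κ γ)
      (g : IwasawaAlgebra p), κ.IsCyclotomic → κ.IsTopGenerator γ → D.IsTorsion →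
      D.charIdeal = Ideal.span {g} → HasUnitContent g →
        p ^ (lam g + ∑ v ∈ S₀, delta W p v) =
          Nat.card (residualLineH1 W p κ S₀ Φ₀ hΦ) * Nat.card (residualQuotSelmer W p κ S₀ Φ₀ hΦ))
    (hn : ∀ (κ : ZpExtension ℚ p), κ.IsCyclotomic →
      p ^ (n + ∑ v ∈ S₀, delta W p v) =
        Nat.card (residualLineH1 W p κ S₀ Φ₀ hΦ) * Nat.card (residualQuotSelmer W p κ S₀ Φ₀ hΦ))
    {κ : ZpExtension ℚ p} {γ : Field.absoluteGaloisGroup ℚ} (D : W.SelmerDualData κ γ)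
    (g : IwasawaAlgebra p) (hκ : κ.IsCyclotomic) (hγ : κ.IsTopGenerator γ) (hDt : D.IsTorsion)
    (hchar : D.charIdeal = Ideal.span {g}) (hμg : HasUnitContent g) : lam g = n := by
  have hpow : p ^ (lam g + ∑ v ∈ S₀, delta W p v) = p ^ (n + ∑ v ∈ S₀, delta W p v) :=
    (hcount D g hκ hγ hDt hchar hμg).trans (hn κ hκ).symm
  have := Nat.pow_right_injective hp.out.two_le hpow
  omega

end Evaluation

end Summit.BirchSwinnertonDyer.Rank1Residual.Additive

end
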